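import Mathlib.Analysis.InnerProductSpace.Calculus
import Mathlib.Analysis.Calculus.MeanValue
import Mathlib.Analysis.SpecialFunctions.ExpDeriv
import Mathlib.Analysis.SpecialFunctions.Sqrt
import HarnessLib

/-!
# Carleman linearisation of a dissipative quadratic ODE: truncation error (vector case)

Liu–Kolden–Krovi–Loureiro–Trivisa–Childs, *Efficient quantum algorithm for dissipative nonlinear
differential equations*, PNAS 118 (2021) e2026805118 = arXiv:2011.03185 [LiuEtAl2021Carleman],
§4.1.1 (arXiv numbering §3): for `du/dt = F₂ u^{⊗2} + F₁ u` (`F₀ = 0`) with Carleman variables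
`ŷ_j ≈ u^{⊗j}`, `j = 1, …, N`, the truncation errors `η_j := u^{⊗j} − ŷ_j` solve the upper
block-bidiagonal system `η_j' = A_j^j η_j + A_{j+1}^j η_{j+1}` (`j < N`),
`η_N' = A_N^N η_N + A_{N+1}^N u^{⊗(N+1)}`, `η(0) = 0` (held text `paper:arxiv-2011.03185`, p0009),
and **Corollary 1** states `‖η_j(t)‖ ≤ ‖u_in‖^j R^{N+1−j}` with `R = ‖u_in‖‖F₂‖/|Re λ₁|`.

The printed proof uses exactly three facts about the Kronecker-structured blocks:

* (D) dissipativity of the diagonal blocks, `η_j†[A_j^j + (A_j^j)†]η_j ≤ 2j Re(λ₁)‖η_j‖²`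
  (p0009 L106; for `j = 1` this is `u†(F₁ + F₁†)u ≤ 2Re(λ₁)‖u‖²`, p0008 L33), whence
  `‖e^{A_j^j t}‖ ≤ e^{j Re(λ₁) t}` (p0009 L229);
* (C) the coupling bound `‖A_{j+1}^j‖ = j‖F₂‖` (p0009 L229, from eq. tensor2);
* (K) multiplicativity `‖u^{⊗j}‖ = ‖u‖^j` together with **Lemma 1**, `‖u(t)‖ ≤ ‖u_in‖`
  (p0008 L15–L39: `d‖u‖²/dt ≤ 2‖F₂‖‖u‖³ + 2Re(λ₁)‖u‖²` under `R < 1`).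

This file proves the vector-valued mechanism in real inner-product spaces, with (D), (C), (K) as
the hypotheses, for ARBITRARY functions satisfying the differential equations on `[0, ∞)`
(`HasDerivAt` hypotheses; no existence theory is invoked):

* `norm_le_of_hasDerivAt_dissipative_forced` — the back-substitution step in a real inner-product
  space: `e' = a + f` with `⟪e, a⟫ ≤ κ‖e‖²` (`κ < 0`), `e(0) = 0`, `‖f‖ ≤ B` on `[0,t)` ⇒
  `‖e(t)‖ ≤ B(1 − e^{κt})/|κ| ≤ B/|κ|` (energy estimate on `√(ε² + ‖e^{−κs}e(s)‖²)` + Mathlib's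
  fencing lemma `image_le_of_deriv_right_le_deriv_boundary`, then `ε → 0`).
* `norm_le_norm_init` — Lemma 1, homogeneous vector case: `u' = a + q`, `⟪u, a⟫ ≤ μ‖u‖²`,
  `‖q‖ ≤ c‖u‖²`, `c‖u(0)‖ < −μ` (i.e. `R < 1`) ⇒ `‖u(t)‖ ≤ ‖u(0)‖`.
* `norm_le_norm_init_forced` — Lemma 1 with forcing `‖f‖ ≤ f₀` (weak form): `R < 1` as
  `c‖u(0)‖ + f₀/‖u(0)‖ < −μ` ⇒ `‖u(t)‖ ≤ ‖u(0)‖` (appended at the end of the file).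
* `truncation_error_norm_le` — Corollary 1 (first bound) for a chain of real inner-product spaces
  `E j` carrying the errors: linear blocks `A j` with dissipativity constant `jμ`, couplings `C j`
  with `‖C j x‖ ≤ j c ‖x‖`, top forcing bounded through `‖U (N+1)‖ ≤ M^{N+1}` ⇒
  `‖U j (t) − Y j (t)‖ ≤ M^j (Mc/|μ|)^{N+1−j}` — backward induction, one factor `Mc/|μ|` per step.
* `truncation_error_norm_le_of_R_lt_one` — the printed form: with (K) as the hypothesis
  `‖U j‖ ≤ ‖U 1‖^j` and `R := ‖U 1 (0)‖ c/|μ| < 1`, Lemma 1 supplies `M = ‖U 1 (0)‖` and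
  `‖U j (t) − Y j (t)‖ ≤ ‖U 1(0)‖^j R^{N+1−j}`.

On the constant `μ`: the paper writes `μ = Re λ₁(F₁)` (largest real part of an eigenvalue of the
diagonalizable matrix `F₁`, p0005 L16) and USES the quadratic-form inequality (D); (D) with
`μ = Re λ₁` holds for normal `F₁`, and in general (D) says that `μ` dominates the logarithmic
2-norm `λ_max((F₁ + F₁†)/2)` — the hypothesis under which [ForetsPouly2017, Thm. 4.2] is stated.
We therefore take (D) itself as the hypothesis, which is what the printed proof consumes.

-- TODO(general form): the concrete Kronecker realisation (`E j = ℝ^{n^j}`, `A_j^j = Σ I⊗…⊗F₁⊗…⊗I`,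
-- `A_{j+1}^j = Σ I⊗…⊗F₂⊗…⊗I`) and the verification that it satisfies (D), (C), (K); the
-- inhomogeneous Lemma 2; the sharper `j = 1` bound `‖u_in‖R^N(1 − e^{Re(λ₁)t})^N`. The scalar case
-- `n = 1` with everything explicit is `Literature.Analysis.ODE.CarlemanTruncation`.

Consumers in this project: the `pub-qadeq` adjudications of Carleman-based quantum ODE/PDE claims
(CLAIMS A-13, A-116, A-142, A-147), which cite the `R < 1` convergence condition and the role of
the dissipativity constant.

## References

* J.-P. Liu, H. Ø. Kolden, H. K. Krovi, N. F. Loureiro, K. Trivisa, A. M. Childs, *Efficient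
  quantum algorithm for dissipative nonlinear differential equations*, PNAS 118 (35) (2021),
  arXiv:2011.03185, Lemma 1 and Corollary 1 with their proofs. [LiuEtAl2021Carleman]
* M. Forets, A. Pouly, *Explicit error bounds for Carleman linearization*, arXiv:1711.02552
  (2017), Thm. 4.2. [ForetsPouly2017]
-/

noncomputable section

open Set Real
open scoped InnerProductSpace

namespace Literature.Analysis.ODE.Carleman

section Step

variable {E : Type*} [NormedAddCommGroup E] [InnerProductSpace ℝ E]

/-- Derivative of the scalar integrating factor `s ↦ exp(−κ s)`. [folklore] -/
private theorem hasDerivAt_exp_neg_mul_vec (κ s : ℝ) :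
    HasDerivAt (fun s : ℝ => exp (-(κ * s))) (exp (-(κ * s)) * (-κ)) s := by
  have h := ((hasDerivAt_id s).const_mul κ).neg.exp
  simpa using h

/-- **Back-substitution step, vector case** (the energy form of
`η_j(t) = ∫₀ᵗ e^{A(t−s)} f(s) ds`, `‖η_j(t)‖ ≤ sup‖f‖ ∫₀ᵗ e^{κ(t−s)} ds` when
`x†(A + A†)x ≤ 2κ‖x‖²`): in a real inner-product space let `e' = a + f` on `[0, ∞)` with the
one-sided bound `⟪e(s), a(s)⟫ ≤ κ‖e(s)‖²`, `κ < 0`, `e(0) = 0` and `‖f‖ ≤ B` on `[0, t)`. Then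
`‖e(t)‖ ≤ B (1 − e^{κt}) / (−κ)`.
(The bounds on `η_N`, `η_{N−1}` in the proof of Corollary 1, arXiv:2011.03185 §4.1.1.)
[cite: LiuEtAl2021Carleman, proof of Corollary 1] -/
theorem norm_le_of_hasDerivAt_dissipative_forced {e a f : ℝ → E} {κ B t : ℝ} (hκ : κ < 0)
    (ht : 0 ≤ t)
    (he : ∀ s, 0 ≤ s → HasDerivAt e (a s + f s) s)
    (ha : ∀ s, 0 ≤ s → ⟪e s, a s⟫_ℝ ≤ κ * ‖e s‖ ^ 2)
    (he0 : e 0 = 0) (hf : ∀ s ∈ Ico 0 t, ‖f s‖ ≤ B) :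
    ‖e t‖ ≤ B * (1 - exp (κ * t)) / (-κ) := by
  rcases ht.eq_or_lt with rfl | ht'
  · simp [he0]
  have hB : 0 ≤ B := (norm_nonneg _).trans (hf 0 ⟨le_rfl, ht'⟩)
  have hκ' : 0 < -κ := neg_pos.mpr hκ
  -- integrating factor: g s = exp(-κ s) • e s
  set g : ℝ → E := fun s => exp (-(κ * s)) • e s with hg
  set g' : ℝ → E := fun s => exp (-(κ * s)) • (a s + f s) + (exp (-(κ * s)) * (-κ)) • e s
    with hg'def
  have hg' : ∀ s, 0 ≤ s → HasDerivAt g (g' s) s := fun s hs =>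
    (hasDerivAt_exp_neg_mul_vec κ s).smul (he s hs)
  have hg0 : g 0 = 0 := by simp [hg, he0]
  have hnorm_g : ∀ s, ‖g s‖ = exp (-(κ * s)) * ‖e s‖ := fun s => by
    rw [hg, norm_smul, Real.norm_eq_abs, abs_of_pos (exp_pos _)]
  -- the energy inequality ⟪g, g'⟫ ≤ exp(-κ s) B ‖g‖ on [0, t)
  have hinner : ∀ s ∈ Ico 0 t, ⟪g s, g' s⟫_ℝ ≤ exp (-(κ * s)) * B * ‖g s‖ := by
    intro s hs
    have hc : 0 < exp (-(κ * s)) := exp_pos _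
    have h1 : ⟪g s, g' s⟫_ℝ = exp (-(κ * s)) ^ 2 *
        (⟪e s, a s⟫_ℝ + ⟪e s, f s⟫_ℝ - κ * ‖e s‖ ^ 2) := by
      simp only [hg, hg'def, inner_add_right, inner_smul_left, inner_smul_right, inner_add_right,
        real_inner_self_eq_norm_sq, RCLike.conj_to_real]
      ring
    have h2 : ⟪e s, f s⟫_ℝ ≤ ‖e s‖ * B :=
      (real_inner_le_norm _ _).trans (mul_le_mul_of_nonneg_left (hf s hs) (norm_nonneg _))
    have h3 : ⟪e s, a s⟫_ℝ + ⟪e s, f s⟫_ℝ - κ * ‖e s‖ ^ 2 ≤ ‖e s‖ * B := by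
      linarith [ha s hs.1]
    calc ⟪g s, g' s⟫_ℝ = exp (-(κ * s)) ^ 2 * (⟪e s, a s⟫_ℝ + ⟪e s, f s⟫_ℝ - κ * ‖e s‖ ^ 2) := h1
      _ ≤ exp (-(κ * s)) ^ 2 * (‖e s‖ * B) := mul_le_mul_of_nonneg_left h3 (by positivity)
      _ = exp (-(κ * s)) * B * ‖g s‖ := by rw [hnorm_g]; ring
  -- target bound K and the ε-regularised norm w_ε = √(ε² + ‖g‖²)
  set K : ℝ := B * (exp (-(κ * t)) - 1) / (-κ) with hK
  have hgK : ‖g t‖ ≤ K := by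
    refine le_of_forall_pos_le_add fun ε hε => ?_
    set w : ℝ → ℝ := fun s => √(ε ^ 2 + ‖g s‖ ^ 2) with hw
    have hwpos : ∀ s, 0 < ε ^ 2 + ‖g s‖ ^ 2 := fun s => by positivity
    have hw' : ∀ s, 0 ≤ s →
        HasDerivAt w ((2 * ⟪g s, g' s⟫_ℝ) / (2 * √(ε ^ 2 + ‖g s‖ ^ 2))) s := by
      intro s hs
      have h := ((hg' s hs).norm_sq.const_add (ε ^ 2)).sqrt (hwpos s).ne'
      simpa [hw] using h
    have hgw : ∀ s, ‖g s‖ ≤ w s := fun s => by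
      rw [hw]
      calc ‖g s‖ = √(‖g s‖ ^ 2) := (Real.sqrt_sq (norm_nonneg _)).symm
        _ ≤ √(ε ^ 2 + ‖g s‖ ^ 2) := Real.sqrt_le_sqrt (by nlinarith [sq_nonneg ε])
    -- majorant
    set Bm : ℝ → ℝ := fun s => ε + B * (exp (-(κ * s)) - 1) / (-κ) with hBm
    have hBm' : ∀ s, HasDerivAt Bm (B * exp (-(κ * s))) s := by
      intro s
      have h := ((((hasDerivAt_exp_neg_mul_vec κ s).sub_const 1).const_mul B).div_const
        (-κ)).const_add ε
      refine h.congr_deriv ?_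
      have hκ0 : κ ≠ 0 := hκ.ne
      field_simp
    have hcont : ContinuousOn w (Icc 0 t) :=
      fun s hs => (hw' s hs.1).continuousAt.continuousWithinAt
    have key := image_le_of_deriv_right_le_deriv_boundary (f := w) (a := 0) (b := t)
      (B := Bm) (B' := fun s => B * exp (-(κ * s))) hcont
      (fun s hs => (hw' s hs.1).hasDerivWithinAt)
      (by simp [hw, hBm, hg0, Real.sqrt_sq hε.le])
      (fun s _ => (hBm' s).continuousAt.continuousWithinAt)
      (fun s _ => (hBm' s).hasDerivWithinAt)
      (fun s hs => by
        have hws : 0 < w s := Real.sqrt_pos.mpr (hwpos s)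
        have hsq : √(ε ^ 2 + ‖g s‖ ^ 2) = w s := rfl
        rw [hsq, mul_div_mul_left _ _ (two_ne_zero), div_le_iff₀ hws]
        calc ⟪g s, g' s⟫_ℝ ≤ exp (-(κ * s)) * B * ‖g s‖ := hinner s hs
          _ ≤ exp (-(κ * s)) * B * w s :=
            mul_le_mul_of_nonneg_left (hgw s) (by positivity)
          _ = B * exp (-(κ * s)) * w s := by ring)
      (right_mem_Icc.mpr ht)
    -- key : w t ≤ ε + K
    calc ‖g t‖ ≤ w t := hgw t
      _ ≤ Bm t := key
      _ = K + ε := by rw [hBm, hK]; ring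
  -- undo the integrating factor
  have hgt : ‖e t‖ = exp (κ * t) * ‖g t‖ := by
    rw [hnorm_g, ← mul_assoc, ← Real.exp_add, add_neg_cancel, Real.exp_zero, one_mul]
  have hprod : exp (κ * t) * (exp (-(κ * t)) - 1) = 1 - exp (κ * t) := by
    rw [mul_sub, ← Real.exp_add, add_neg_cancel, Real.exp_zero, mul_one]
  calc ‖e t‖ = exp (κ * t) * ‖g t‖ := hgt
    _ ≤ exp (κ * t) * K := mul_le_mul_of_nonneg_left hgK (exp_pos _).le
    _ = B * (exp (κ * t) * (exp (-(κ * t)) - 1)) / (-κ) := by rw [hK]; ring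
    _ = B * (1 - exp (κ * t)) / (-κ) := by rw [hprod]

/-- Time-uniform form of the vector back-substitution step (`∫₀ᵗ e^{κ(t−s)} ds ≤ 1/|κ|`): under the
hypotheses of `norm_le_of_hasDerivAt_dissipative_forced` and `0 ≤ B`, `‖e(t)‖ ≤ B / (−κ)`.
(The bound `∫ e^{(N−k)Re(λ₁)(s'−s)} ds ≤ 1/((N−k)|Re λ₁|)` in the proof of Corollary 1.)
[cite: LiuEtAl2021Carleman, proof of Corollary 1] -/
theorem norm_le_div_of_hasDerivAt_dissipative_forced {e a f : ℝ → E} {κ B t : ℝ} (hκ : κ < 0)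
    (ht : 0 ≤ t) (hB : 0 ≤ B)
    (he : ∀ s, 0 ≤ s → HasDerivAt e (a s + f s) s)
    (ha : ∀ s, 0 ≤ s → ⟪e s, a s⟫_ℝ ≤ κ * ‖e s‖ ^ 2)
    (he0 : e 0 = 0) (hf : ∀ s ∈ Ico 0 t, ‖f s‖ ≤ B) :
    ‖e t‖ ≤ B / (-κ) := by
  have h := norm_le_of_hasDerivAt_dissipative_forced hκ ht he ha he0 hf
  have hκ' : 0 < -κ := neg_pos.mpr hκ
  refine h.trans ?_
  rw [div_le_div_iff_of_pos_right hκ']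
  have : 0 ≤ B * exp (κ * t) := mul_nonneg hB (exp_pos _).le
  linarith

/-! ### Lemma 1, homogeneous vector case: the solution does not grow -/

/-- **Liu et al. Lemma 1, homogeneous vector case.** Let `u' = a + q` on `[0, ∞)` in a real
inner-product space with `⟪u, a⟫ ≤ μ‖u‖²` (the dissipativity inequality
`u†(F₁ + F₁†)u ≤ 2μ‖u‖²`) and `‖q‖ ≤ c‖u‖²` (the quadratic term, `c = ‖F₂‖`). If
`c‖u(0)‖ < −μ` (the condition `R < 1` with `F₀ = 0`; it forces `μ < 0`) and `u(0) ≠ 0`, then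
`‖u(t)‖ ≤ ‖u(0)‖` for all `t ≥ 0`: on the level set `‖u‖² = ‖u(0)‖²` one has
`(‖u‖²)' = 2⟪u, a + q⟫ ≤ 2‖u(0)‖²(μ + c‖u(0)‖) < 0`, so `‖u‖²` never crosses `‖u(0)‖²` from below
(Mathlib's fencing lemma).
(Proof of Lemma 1: `d‖u‖²/dt ≤ 2‖F₂‖‖u‖³ + 2Re(λ₁)‖u‖²`, arXiv:2011.03185 §4.1.1.)
[cite: LiuEtAl2021Carleman, Lemma 1 (case F₀ = 0)] -/
theorem norm_le_norm_init {u a q : ℝ → E} {μ c : ℝ}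
    (hu : ∀ s, 0 ≤ s → HasDerivAt u (a s + q s) s)
    (ha : ∀ s, 0 ≤ s → ⟪u s, a s⟫_ℝ ≤ μ * ‖u s‖ ^ 2)
    (hq : ∀ s, 0 ≤ s → ‖q s‖ ≤ c * ‖u s‖ ^ 2)
    (hR : c * ‖u 0‖ < -μ) (h0 : u 0 ≠ 0) {t : ℝ} (ht : 0 ≤ t) : ‖u t‖ ≤ ‖u 0‖ := by
  have hsq : ∀ s, 0 ≤ s →
      HasDerivAt (fun s => ‖u s‖ ^ 2) (2 * ⟪u s, a s + q s⟫_ℝ) s :=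
    fun s hs => (hu s hs).norm_sq
  have hcont : ContinuousOn (fun s => ‖u s‖ ^ 2) (Icc 0 t) :=
    fun s hs => (hsq s hs.1).continuousAt.continuousWithinAt
  have key := image_le_of_deriv_right_lt_deriv_boundary (f := fun s => ‖u s‖ ^ 2)
    (f' := fun s => 2 * ⟪u s, a s + q s⟫_ℝ) (a := 0) (b := t)
    (B := fun _ => ‖u 0‖ ^ 2) (B' := fun _ => 0) hcont
    (fun s hs => (hsq s hs.1).hasDerivWithinAt) le_rfl (fun _ => hasDerivAt_const _ _)
    (fun s hs heq => by
      -- on the level set ‖u s‖ = ‖u 0‖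
      have hns : ‖u s‖ = ‖u 0‖ := by
        have := congrArg Real.sqrt heq
        simpa [Real.sqrt_sq (norm_nonneg _)] using this
      have hpos : 0 < ‖u 0‖ := norm_pos_iff.mpr h0
      have h1 : ⟪u s, q s⟫_ℝ ≤ ‖u s‖ * (c * ‖u s‖ ^ 2) :=
        (real_inner_le_norm _ _).trans (mul_le_mul_of_nonneg_left (hq s hs.1) (norm_nonneg _))
      have h2 : ⟪u s, a s + q s⟫_ℝ ≤ ‖u 0‖ ^ 2 * (μ + c * ‖u 0‖) := by
        rw [inner_add_right]
        have := ha s hs.1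
        rw [hns] at h1 this
        nlinarith
      have hneg : μ + c * ‖u 0‖ < 0 := by linarith
      have : ‖u 0‖ ^ 2 * (μ + c * ‖u 0‖) < 0 := mul_neg_of_pos_of_neg (by positivity) hneg
      show 2 * ⟪u s, a s + q s⟫_ℝ < 0
      linarith)
    (right_mem_Icc.mpr ht)
  -- key : ‖u t‖ ^ 2 ≤ ‖u 0‖ ^ 2
  exact (sq_le_sq₀ (norm_nonneg _) (norm_nonneg _)).mp key

end Step

/-! ### Corollary 1: the truncation error of Carleman linearisation, vector case -/

section Chain

variable {E : ℕ → Type*} [∀ j, NormedAddCommGroup (E j)] [∀ j, InnerProductSpace ℝ (E j)]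

/-- **Liu et al. Corollary 1 (first bound), vector case, with an a-priori bound.** A chain of real
inner-product spaces `E j` carries the Carleman blocks: the exact variables `U j` (`= u^{⊗j}`)
satisfy `(U j)' = A j (U j) + C j (U (j+1))` for `1 ≤ j ≤ N` (the homogeneous infinite system,
eq. (exact) on p0009), the truncated variables `Y j` satisfy the same equations with
`Y (N+1) ≡ 0` and exact initial data `Y j (0) = U j (0)`; the diagonal blocks are dissipative with
constant `jμ` (fact (D): `⟪x, A j x⟫ ≤ jμ‖x‖²`, `μ < 0`), the couplings satisfy
`‖C j x‖ ≤ j c ‖x‖` (fact (C), `c = ‖F₂‖`), and the top forcing is controlled by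
`‖U (N+1)‖ ≤ M^{N+1}` (fact (K) with Lemma 1). Then for `1 ≤ j ≤ N`, `t ≥ 0`:
`‖U j (t) − Y j (t)‖ ≤ M^j (M c/|μ|)^{N+1−j}` — backward substitution from `j = N` (forcing
bounded by `N c M^{N+1}`) down to `j = 1`, each step costing one factor `M c/|μ|`.
[cite: LiuEtAl2021Carleman, Corollary 1 (first bound) and its proof by backward substitution] -/
theorem truncation_error_norm_le {U Y : (j : ℕ) → ℝ → E j} {A : (j : ℕ) → E j →ₗ[ℝ] E j}
    {C : (j : ℕ) → E (j + 1) →ₗ[ℝ] E j} {μ c M : ℝ} {N : ℕ} (hμ : μ < 0) (hc : 0 ≤ c)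
    (hM : 0 ≤ M)
    (hA : ∀ j, 1 ≤ j → j ≤ N → ∀ x : E j, ⟪x, A j x⟫_ℝ ≤ (j : ℝ) * μ * ‖x‖ ^ 2)
    (hC : ∀ j, 1 ≤ j → j ≤ N → ∀ x : E (j + 1), ‖C j x‖ ≤ (j : ℝ) * c * ‖x‖)
    (hU : ∀ j, 1 ≤ j → j ≤ N → ∀ s, 0 ≤ s →
      HasDerivAt (U j) (A j (U j s) + C j (U (j + 1) s)) s)
    (hbound : ∀ s, 0 ≤ s → ‖U (N + 1) s‖ ≤ M ^ (N + 1))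
    (hY : ∀ j, 1 ≤ j → j ≤ N → ∀ s, 0 ≤ s →
      HasDerivAt (Y j) (A j (Y j s) + C j (Y (j + 1) s)) s)
    (hYN : ∀ s, Y (N + 1) s = 0)
    (hY0 : ∀ j, 1 ≤ j → j ≤ N → Y j 0 = U j 0)
    {j : ℕ} (hj1 : 1 ≤ j) (hjN : j ≤ N) {t : ℝ} (ht : 0 ≤ t) :
    ‖U j t - Y j t‖ ≤ M ^ j * (M * c / (-μ)) ^ (N + 1 - j) := by
  have hμ' : 0 < -μ := neg_pos.mpr hμ
  set R : ℝ := M * c / (-μ) with hR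
  have hR0 : 0 ≤ R := by positivity
  -- P m : the bound for the index j with j + m = N + 1, by induction on m, generalizing j
  have main : ∀ m j, j + m = N + 1 → 1 ≤ j → ∀ t, 0 ≤ t →
      ‖U j t - Y j t‖ ≤ M ^ j * R ^ m := by
    intro m
    induction m with
    | zero =>
      intro j hjm _ t ht
      have hj : j = N + 1 := by omega
      subst hj
      simpa [hYN] using hbound t ht
    | succ m ih =>
      intro j hjm hj1 t ht
      have hjN : j ≤ N := by omega
      have ih' := ih (j + 1) (by omega) (by omega)
      -- error function and its ODE: η' = A j η + C j η_{j+1}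
      have hderiv : ∀ s, 0 ≤ s → HasDerivAt (fun s => U j s - Y j s)
          (A j (U j s - Y j s) + C j (U (j + 1) s - Y (j + 1) s)) s := by
        intro s hs
        have h := (hU j hj1 hjN s hs).sub (hY j hj1 hjN s hs)
        refine h.congr_deriv ?_
        simp only [map_sub]
        abel
      have hforce : ∀ s ∈ Ico 0 t,
          ‖C j (U (j + 1) s - Y (j + 1) s)‖ ≤ (j : ℝ) * c * (M ^ (j + 1) * R ^ m) := by
        intro s hs
        exact (hC j hj1 hjN _).trans (mul_le_mul_of_nonneg_left (ih' s hs.1) (by positivity))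
      have h0 : U j 0 - Y j 0 = 0 := by rw [hY0 j hj1 hjN, sub_self]
      have hjpos : (0 : ℝ) < j := by exact_mod_cast hj1
      have hκ : (j : ℝ) * μ < 0 := mul_neg_of_pos_of_neg hjpos hμ
      have hdiss : ∀ s, 0 ≤ s →
          ⟪U j s - Y j s, A j (U j s - Y j s)⟫_ℝ ≤ (j : ℝ) * μ * ‖U j s - Y j s‖ ^ 2 :=
        fun s _ => hA j hj1 hjN _
      have step := norm_le_div_of_hasDerivAt_dissipative_forced (e := fun s => U j s - Y j s)
        (a := fun s => A j (U j s - Y j s)) (f := fun s => C j (U (j + 1) s - Y (j + 1) s))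
        hκ ht (by positivity) hderiv hdiss h0 hforce
      -- B / (-κ) = M^j R^{m+1}
      have e : (j : ℝ) * c * (M ^ (j + 1) * R ^ m) / -((j : ℝ) * μ) = M ^ j * R ^ (m + 1) := by
        rw [hR, pow_succ, pow_succ]
        field_simp
      calc ‖U j t - Y j t‖ ≤ (j : ℝ) * c * (M ^ (j + 1) * R ^ m) / -((j : ℝ) * μ) := step
        _ = M ^ j * R ^ (m + 1) := e
  exact main (N + 1 - j) j (by omega) hj1 t ht

/-- **Liu et al. Corollary 1 (first bound), vector case, printed form.** In the setting of
`truncation_error_norm_le`, assume instead of an a-priori bound the multiplicativity (K)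
`‖U j‖ ≤ ‖U 1‖^j` of the Carleman variables (`‖u^{⊗j}‖ = ‖u‖^j`) and the condition
`R := ‖U 1 (0)‖ c/|μ| < 1` with `U 1 (0) ≠ 0`. Then Lemma 1 (`norm_le_norm_init`, applied to
`(U 1)' = A 1 (U 1) + C 1 (U 2)` with `‖C 1 (U 2)‖ ≤ c‖U 1‖²`) gives `‖U 1 (t)‖ ≤ ‖U 1 (0)‖`,
and for `1 ≤ j ≤ N`, `t ≥ 0`: `‖U j (t) − Y j (t)‖ ≤ ‖U 1 (0)‖^j R^{N+1−j}`.
[cite: LiuEtAl2021Carleman, Corollary 1 (first bound, ‖η_j(t)‖ ≤ ‖u_in‖^j R^{N+1−j})] -/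
theorem truncation_error_norm_le_of_R_lt_one {U Y : (j : ℕ) → ℝ → E j}
    {A : (j : ℕ) → E j →ₗ[ℝ] E j} {C : (j : ℕ) → E (j + 1) →ₗ[ℝ] E j} {μ c : ℝ} {N : ℕ}
    (hμ : μ < 0) (hc : 0 ≤ c)
    (hA : ∀ j, 1 ≤ j → j ≤ N → ∀ x : E j, ⟪x, A j x⟫_ℝ ≤ (j : ℝ) * μ * ‖x‖ ^ 2)
    (hC : ∀ j, 1 ≤ j → j ≤ N → ∀ x : E (j + 1), ‖C j x‖ ≤ (j : ℝ) * c * ‖x‖)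
    (hU : ∀ j, 1 ≤ j → j ≤ N → ∀ s, 0 ≤ s →
      HasDerivAt (U j) (A j (U j s) + C j (U (j + 1) s)) s)
    (hpow : ∀ j, 1 ≤ j → j ≤ N + 1 → ∀ s, 0 ≤ s → ‖U j s‖ ≤ ‖U 1 s‖ ^ j)
    (hR : ‖U 1 0‖ * c / (-μ) < 1) (h0 : U 1 0 ≠ 0)
    (hY : ∀ j, 1 ≤ j → j ≤ N → ∀ s, 0 ≤ s →
      HasDerivAt (Y j) (A j (Y j s) + C j (Y (j + 1) s)) s)
    (hYN : ∀ s, Y (N + 1) s = 0)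
    (hY0 : ∀ j, 1 ≤ j → j ≤ N → Y j 0 = U j 0)
    {j : ℕ} (hj1 : 1 ≤ j) (hjN : j ≤ N) {t : ℝ} (ht : 0 ≤ t) :
    ‖U j t - Y j t‖ ≤ ‖U 1 0‖ ^ j * (‖U 1 0‖ * c / (-μ)) ^ (N + 1 - j) := by
  have hμ' : 0 < -μ := neg_pos.mpr hμ
  have hN : 1 ≤ N := hj1.trans hjN
  -- Lemma 1 for U 1: a = A 1 (U 1), q = C 1 (U 2)
  have hR' : c * ‖U 1 0‖ < -μ := by
    rw [div_lt_one hμ'] at hR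
    linarith [mul_comm (‖U 1 0‖) c]
  have hapriori : ∀ s, 0 ≤ s → ‖U 1 s‖ ≤ ‖U 1 0‖ := by
    intro s hs
    refine norm_le_norm_init (u := U 1) (a := fun s => A 1 (U 1 s)) (q := fun s => C 1 (U 2 s))
      (μ := μ) (c := c) (hU 1 le_rfl hN) (fun s _ => ?_) (fun s hs => ?_) hR' h0 hs
    · simpa using hA 1 le_rfl hN (U 1 s)
    · calc ‖C 1 (U 2 s)‖ ≤ (1 : ℕ) * c * ‖U 2 s‖ := hC 1 le_rfl hN _
        _ ≤ (1 : ℕ) * c * ‖U 1 s‖ ^ 2 :=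
          mul_le_mul_of_nonneg_left (hpow 2 (by norm_num) (by omega) s hs) (by positivity)
        _ = c * ‖U 1 s‖ ^ 2 := by simp
  have hbound : ∀ s, 0 ≤ s → ‖U (N + 1) s‖ ≤ ‖U 1 0‖ ^ (N + 1) := fun s hs =>
    (hpow (N + 1) (by omega) le_rfl s hs).trans
      (pow_le_pow_left₀ (norm_nonneg _) (hapriori s hs) _)
  exact truncation_error_norm_le hμ hc (norm_nonneg _) hA hC hU hbound hY hYN hY0 hj1 hjN ht

/-- The headline case `j = 1`, vector form: under `R < 1` the first Carleman block approximates the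
solution itself to `‖U 1 (t) − Y 1 (t)‖ ≤ ‖U 1 (0)‖ R^N`, exponentially small in the truncation
order `N`. [cite: LiuEtAl2021Carleman, Corollary 1 (case j = 1, first bound)] -/
theorem truncation_error_first_norm_le_of_R_lt_one {U Y : (j : ℕ) → ℝ → E j}
    {A : (j : ℕ) → E j →ₗ[ℝ] E j} {C : (j : ℕ) → E (j + 1) →ₗ[ℝ] E j} {μ c : ℝ} {N : ℕ}
    (hμ : μ < 0) (hc : 0 ≤ c) (hN : 1 ≤ N)
    (hA : ∀ j, 1 ≤ j → j ≤ N → ∀ x : E j, ⟪x, A j x⟫_ℝ ≤ (j : ℝ) * μ * ‖x‖ ^ 2)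
    (hC : ∀ j, 1 ≤ j → j ≤ N → ∀ x : E (j + 1), ‖C j x‖ ≤ (j : ℝ) * c * ‖x‖)
    (hU : ∀ j, 1 ≤ j → j ≤ N → ∀ s, 0 ≤ s →
      HasDerivAt (U j) (A j (U j s) + C j (U (j + 1) s)) s)
    (hpow : ∀ j, 1 ≤ j → j ≤ N + 1 → ∀ s, 0 ≤ s → ‖U j s‖ ≤ ‖U 1 s‖ ^ j)
    (hR : ‖U 1 0‖ * c / (-μ) < 1) (h0 : U 1 0 ≠ 0)
    (hY : ∀ j, 1 ≤ j → j ≤ N → ∀ s, 0 ≤ s →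
      HasDerivAt (Y j) (A j (Y j s) + C j (Y (j + 1) s)) s)
    (hYN : ∀ s, Y (N + 1) s = 0)
    (hY0 : ∀ j, 1 ≤ j → j ≤ N → Y j 0 = U j 0)
    {t : ℝ} (ht : 0 ≤ t) :
    ‖U 1 t - Y 1 t‖ ≤ ‖U 1 0‖ * (‖U 1 0‖ * c / (-μ)) ^ N := by
  have h := truncation_error_norm_le_of_R_lt_one hμ hc hA hC hU hpow hR h0 hY hYN hY0 le_rfl hN ht
  simpa using h

end Chain

/-! ### Lemma 1 with forcing (inhomogeneous case, weak form) -/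

section Forced

variable {E : Type*} [NormedAddCommGroup E] [InnerProductSpace ℝ E]

/-- **Liu et al. Lemma 1, vector case with forcing (weak form).** Let `u' = a + q + f` on `[0, ∞)`
in a real inner-product space with `⟪u, a⟫ ≤ μ‖u‖²` (dissipativity, `u†(F₁ + F₁†)u ≤ 2μ‖u‖²`),
`‖q‖ ≤ c‖u‖²` (`c = ‖F₂‖`) and `‖f‖ ≤ f₀` (`f₀ = ‖F₀‖`), and assume the paper's condition `R < 1`
in the form `c‖u(0)‖ + f₀/‖u(0)‖ < −μ` (with `u(0) ≠ 0`). Then `‖u(t)‖ ≤ ‖u(0)‖` for all `t ≥ 0`.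
The paper proves the strict form `‖u(t)‖ < ‖u_in‖ < r₊` by comparison with the Riccati equation
`x' = ax² + bx + c`; the weak inequality — the form Lemma 2 and Corollary 1 consume
(`‖u^{⊗(N+1)}‖ ≤ ‖u_in‖^{N+1}`) — follows from the paper's differential inequality
`d‖u‖²/dt ≤ 2‖F₂‖‖u‖³ + 2Re(λ₁)‖u‖² + 2‖F₀‖‖u‖` alone: on the level set `‖u‖ = ‖u(0)‖` its
right-hand side is `2‖u(0)‖²(μ + c‖u(0)‖ + f₀/‖u(0)‖) < 0` (Mathlib's fencing lemma).
[cite: LiuEtAl2021Carleman, Lemma 1 (R < 1 ⇒ ‖u(t)‖ < ‖u_in‖) and its proof] -/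
theorem norm_le_norm_init_forced {u a q f : ℝ → E} {μ c f₀ : ℝ}
    (hu : ∀ s, 0 ≤ s → HasDerivAt u (a s + q s + f s) s)
    (ha : ∀ s, 0 ≤ s → ⟪u s, a s⟫_ℝ ≤ μ * ‖u s‖ ^ 2)
    (hq : ∀ s, 0 ≤ s → ‖q s‖ ≤ c * ‖u s‖ ^ 2)
    (hf : ∀ s, 0 ≤ s → ‖f s‖ ≤ f₀)
    (hR : c * ‖u 0‖ + f₀ / ‖u 0‖ < -μ) (h0 : u 0 ≠ 0) {t : ℝ} (ht : 0 ≤ t) :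
    ‖u t‖ ≤ ‖u 0‖ := by
  have hpos : 0 < ‖u 0‖ := norm_pos_iff.mpr h0
  have hsq : ∀ s, 0 ≤ s →
      HasDerivAt (fun s => ‖u s‖ ^ 2) (2 * ⟪u s, a s + q s + f s⟫_ℝ) s :=
    fun s hs => (hu s hs).norm_sq
  have hcont : ContinuousOn (fun s => ‖u s‖ ^ 2) (Icc 0 t) :=
    fun s hs => (hsq s hs.1).continuousAt.continuousWithinAt
  have key := image_le_of_deriv_right_lt_deriv_boundary (f := fun s => ‖u s‖ ^ 2)
    (f' := fun s => 2 * ⟪u s, a s + q s + f s⟫_ℝ) (a := 0) (b := t)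
    (B := fun _ => ‖u 0‖ ^ 2) (B' := fun _ => 0) hcont
    (fun s hs => (hsq s hs.1).hasDerivWithinAt) le_rfl (fun _ => hasDerivAt_const _ _)
    (fun s hs heq => by
      -- on the level set ‖u s‖ = ‖u 0‖
      have hns : ‖u s‖ = ‖u 0‖ := by
        have := congrArg Real.sqrt heq
        simpa [Real.sqrt_sq (norm_nonneg _)] using this
      have h1 : ⟪u s, q s⟫_ℝ ≤ ‖u s‖ * (c * ‖u s‖ ^ 2) :=
        (real_inner_le_norm _ _).trans (mul_le_mul_of_nonneg_left (hq s hs.1) (norm_nonneg _))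
      have h1' : ⟪u s, f s⟫_ℝ ≤ ‖u s‖ * f₀ :=
        (real_inner_le_norm _ _).trans (mul_le_mul_of_nonneg_left (hf s hs.1) (norm_nonneg _))
      have h2 : ⟪u s, a s + q s + f s⟫_ℝ ≤
          ‖u 0‖ ^ 2 * μ + ‖u 0‖ * (c * ‖u 0‖ ^ 2) + ‖u 0‖ * f₀ := by
        rw [inner_add_right, inner_add_right]
        have := ha s hs.1
        rw [hns] at h1 h1' this
        linarith
      have hf₀ : f₀ = f₀ / ‖u 0‖ * ‖u 0‖ := (div_mul_cancel₀ f₀ hpos.ne').symm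
      have hneg : ‖u 0‖ ^ 2 * μ + ‖u 0‖ * (c * ‖u 0‖ ^ 2) + ‖u 0‖ * f₀ < 0 := by
        have h3 : μ + c * ‖u 0‖ + f₀ / ‖u 0‖ < 0 := by linarith
        have h4 : ‖u 0‖ ^ 2 * (μ + c * ‖u 0‖ + f₀ / ‖u 0‖) < 0 :=
          mul_neg_of_pos_of_neg (by positivity) h3
        have e : ‖u 0‖ ^ 2 * (μ + c * ‖u 0‖ + f₀ / ‖u 0‖) =
            ‖u 0‖ ^ 2 * μ + ‖u 0‖ * (c * ‖u 0‖ ^ 2) + ‖u 0‖ * (f₀ / ‖u 0‖ * ‖u 0‖) := by ring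
        rw [e, ← hf₀] at h4
        exact h4
      show 2 * ⟪u s, a s + q s + f s⟫_ℝ < 0
      linarith)
    (right_mem_Icc.mpr ht)
  exact (sq_le_sq₀ (norm_nonneg _) (norm_nonneg _)).mp key

end Forced

end Literature.Analysis.ODE.Carleman
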